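import Summits.Ventures.PercRepro.GenQColoopBridge
import Summits.Ventures.PercRepro.GenQSevenFiveCornersCore
import Summits.Ventures.PercRepro.GenQOpenLayersCoreSmall

/-!
# PercRepro — the `(7, 5)` layers on the core reduce to the COLOOP-FREE flats (night-4, gen 2; RULING (rm)(4)(ii))

`SevenFiveLayersCore` (`GenQOpenLayersCore.lean`) asks the three `(7, 5)` balances on every rank-`5` flat of a rank-`7` Core
matroid.  By the coloop bridge (`GenQColoopBridge.lean`) a flat WITH a coloop is «hyperplane + one point», and its balances are
the signed trace sums on a rank-`4` set of the same matroid.  This file states the two halves and composes them: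

* `SevenFiveLayersCoreFree` — the three balances on the coloop-free rank-`5` flats (`mTr M G = 0`: night-2's R5 world);
* `SevenFiveTraceSumsCore` — the trace sums at `t = 2, 3, 4` on every rank-`4` subset of a rank-`7` Core matroid (a finite
  census on the core: rank-`4` subsets of rank-`4` weak-Core matroids, `≤ 10` points);
* `sevenFiveLayersCore_of_free : SevenFiveTraceSumsCore → SevenFiveLayersCoreFree → SevenFiveLayersCore`, hence
  `rls_seven_five_of_free : … → ∀ M, RLS M 7 5` on every finite matroid;
* on a coloop-free flat the «hyperplane + one point» corner cannot occur, so the coloop-free layers follow from corners (ii)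
  and (iii) on the core and the coloop-free low layers (`sevenFiveLayersCoreFree_of_corners`), and
  `rls_seven_five_of_cornersFree : SevenFiveTraceSumsCore → SevenFiveCornerTwoCore → SevenFiveCornerThreeCore →
  SevenFiveLowLayersCoreFree → ∀ M, RLS M 7 5`.

Imports `GenQColoopBridge`, `GenQSevenFiveCornersCore` and `GenQOpenLayersCoreSmall` (for `twoHyp_of_core`).
-/

namespace PercRepro.GenQ

open Finset ThmH PerFlat SixFour ThmN NightThree

/-- **The `(7, 5)` layers on the coloop-free rank-`5` flats of rank-`7` Core matroids** (`mTr M G = 0`). -/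
def SevenFiveLayersCoreFree : Prop :=
  ∀ {β : Type} [DecidableEq β] (M : Matroid β) [M.Finite] (G : Finset β), Core M 7 → G ∈ flatsQ M 5 → mTr M G = 0 →
    (G.card ≤ 10 → 0 ≤ Jq M G 5 2) ∧ 0 ≤ Jq M G 5 3 ∧ 0 ≤ Jq M G 5 4

/-- **The trace sums of `(7, 5)` at `t = 2, 3, 4`** on every rank-`4` subset `H` of a rank-`7` Core matroid. -/
def SevenFiveTraceSumsCore : Prop :=
  ∀ {β : Type} [DecidableEq β] (M : Matroid β) [M.Finite] (H : Finset β), Core M 7 → H ⊆ gr M →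
    M.eRk (H : Set β) = ((4 : ℕ) : ℕ∞) → ∀ t, 2 ≤ t → t ≤ 4 →
    0 ≤ ∑ B ∈ Rq M H 4, ((((4 + 1 : ℕ) : ℚ) + 2 - t) * (1 / (2 + (mTr M B : ℚ))) -
      ((((4 + 1 : ℕ) : ℚ) + 2) / (((4 + 1 : ℕ) : ℚ) + 1)) * dem M H t B)

/-- **The `(7, 5)` layers on the core from the coloop-free flats and the trace sums.** -/
theorem sevenFiveLayersCore_of_free (htr : SevenFiveTraceSumsCore) (hfree : SevenFiveLayersCoreFree) :
    SevenFiveLayersCore := by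
  intro β _ M _ G hc hG _
  by_cases hm : mTr M G = 0
  · exact hfree M G hc hG hm
  · have hGg : G ⊆ gr M := (mem_flatsQ.1 hG).1
    have hr : M.eRk (G : Set β) = ((4 + 1 : ℕ) : ℕ∞) := (mem_flatsQ.1 hG).2.2
    obtain ⟨a, ha, hacl⟩ := exists_coloop_of_mTr_ne_zero hm
    have hτ : M.eRk ((G.erase a : Finset β) : Set β) = ((4 : ℕ) : ℕ∞) := eRk_erase_of_coloop hGg ha hr hacl
    have hτg : G.erase a ⊆ gr M := (Finset.erase_subset a G).trans hGg
    refine ⟨fun _ => ?_, ?_, ?_⟩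
    · exact Jq_nonneg_of_coloop_of_trace hGg ha hr hacl 2
        (htr M (G.erase a) hc hτg hτ 2 (by norm_num) (by norm_num))
    · exact Jq_nonneg_of_coloop_of_trace hGg ha hr hacl 3
        (htr M (G.erase a) hc hτg hτ 3 (by norm_num) (by norm_num))
    · exact Jq_nonneg_of_coloop_of_trace hGg ha hr hacl 4
        (htr M (G.erase a) hc hτg hτ 4 (by norm_num) (by norm_num))

/-- **C-025 at `(7, 5)` on every finite matroid from the coloop-free layers and the trace sums on the core.** -/
theorem rls_seven_five_of_free {α : Type} [DecidableEq α] (htr : SevenFiveTraceSumsCore)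
    (hfree : SevenFiveLayersCoreFree) (M : Matroid α) [M.Finite] : RLS M 7 5 :=
  rls_seven_five_of_layersCore (sevenFiveLayersCore_of_free htr hfree) M

/-- The low layers of `(7, 5)` on the coloop-free rank-`5` flats of rank-`7` Core matroids. -/
def SevenFiveLowLayersCoreFree : Prop :=
  ∀ {β : Type} [DecidableEq β] (M : Matroid β) [M.Finite] (G : Finset β), Core M 7 → G ∈ flatsQ M 5 → mTr M G = 0 →
    (G.card ≤ 10 → 0 ≤ Jq M G 5 2) ∧ 0 ≤ Jq M G 5 3

/-- A coloop-free set has every point in the closure of the rest. -/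
theorem mem_closure_erase_of_mTr_eq_zero {γ : Type} [DecidableEq γ] {M : Matroid γ} [M.Finite] {G : Finset γ}
    (hm : mTr M G = 0) {a : γ} (ha : a ∈ G) : a ∈ M.closure ((G.erase a : Finset γ) : Set γ) := by
  by_contra hacl
  have : a ∈ coloopsOf M G := mem_coloopsOf.2 ⟨ha, hacl⟩
  unfold mTr at hm
  rw [Finset.card_eq_zero] at hm
  rw [hm] at this
  exact Finset.notMem_empty a this

/-- **The coloop-free `(7, 5)` layers on the core from corners (ii), (iii) and the coloop-free low layers**: the
«hyperplane + one point» corner is impossible without a coloop. -/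
theorem sevenFiveLayersCoreFree_of_corners (h2 : SevenFiveCornerTwoCore) (h3 : SevenFiveCornerThreeCore)
    (hlow : SevenFiveLowLayersCoreFree) : SevenFiveLayersCoreFree := by
  intro β _ M _ G hc hG hm
  refine ⟨(hlow M G hc hG hm).1, (hlow M G hc hG hm).2, ?_⟩
  have hF : TwoHyp M G 5 := twoHyp_of_core hc (by norm_num) hG
  have hGg : G ⊆ gr M := (mem_flatsQ.1 hG).1
  have hr : M.eRk (G : Set β) = 5 := by
    have := (mem_flatsQ.1 hG).2.2
    exact_mod_cast this
  by_cases hH : HypPlusLeTwo M G 5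
  · rcases hypPlusLeTwo_cases hr hH with ⟨a, haG, hra⟩ | ⟨a, haG, a', ha'G, hne, hrτ, hacl, ha'cl⟩
    · -- a would be a coloop
      exfalso
      have ha : a ∈ gr M := hGg haG
      have hacl : a ∉ M.closure ((G.erase a : Finset β) : Set β) :=
        notMem_closure_erase_of_eRk_lt ha (by rw [hra, hr]; norm_num)
      exact hacl (mem_closure_erase_of_mTr_eq_zero hm haG)
    · -- corner (ii)
      have ha : a ∈ gr M := hGg haG
      have ha' : a' ∈ gr M := hGg ha'G
      have haτ : a ∉ (G.erase a).erase a' := fun h => (Finset.mem_erase.1 (Finset.mem_of_mem_erase h)).1 rfl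
      have ha'τ : a' ∉ (G.erase a).erase a' := fun h => (Finset.mem_erase.1 h).1 rfl
      have hins : insert a (insert a' ((G.erase a).erase a')) = G := by
        rw [Finset.insert_erase (Finset.mem_erase.2 ⟨fun h => hne h.symm, ha'G⟩), Finset.insert_erase haG]
      have hτg : (G.erase a).erase a' ⊆ gr M :=
        ((Finset.erase_subset _ _).trans (Finset.erase_subset _ _)).trans hGg
      have hrτ' : M.eRk (((G.erase a).erase a' : Finset β) : Set β) = ((4 : ℕ) : ℕ∞) := by
        rw [hrτ]; rfl
      have hrG : M.eRk ((insert a (insert a' ((G.erase a).erase a')) : Finset β) : Set β) = ((4 : ℕ) : ℕ∞) + 1 := by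
        rw [hins, hr]; rfl
      have key := Jq_hyp_add_two_ge_profile (M := M) (q := 4) (t := 4) ha ha' hne haτ ha'τ hacl ha'cl hrτ' hrG
        (by norm_num) (by norm_num)
      rw [hins] at key
      refine le_trans ?_ key
      exact h2 M ((G.erase a).erase a') a a' hc hτg ha ha' hne haτ ha'τ hacl ha'cl hrτ (by rw [hins, hr])
  · exact h3 M G hc hG hF hH

/-- **C-025 at `(7, 5)` on every finite matroid from the trace sums, corners (ii), (iii) and the coloop-free low
layers on the core.** -/
theorem rls_seven_five_of_cornersFree {α : Type} [DecidableEq α] (htr : SevenFiveTraceSumsCore)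
    (h2 : SevenFiveCornerTwoCore) (h3 : SevenFiveCornerThreeCore) (hlow : SevenFiveLowLayersCoreFree) (M : Matroid α)
    [M.Finite] : RLS M 7 5 :=
  rls_seven_five_of_free htr (sevenFiveLayersCoreFree_of_corners h2 h3 hlow) M

end PercRepro.GenQ
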